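import Mathlib
import HarnessLib
import HarnessLib.Audit
import Summits.CriticalPhenomena.Statement
import Literature.Probability.RandomPlanarGeometry.SLEConvergenceCriterion
import Literature.Probability.RandomPlanarGeometry.ConformalRectangle
import Literature.Probability.LatticeModels.SRWPathSpace
import Literature.Probability.RandomPlanarGeometry.SLEUniquenessInLaw
import Literature.Probability.RandomPlanarGeometry.SelfAvoidingWalkProofs
import HarnessLib.Audit.Status.Attr

/-!
Route: SAWExcursionCardy

DORMANT since 2026-08-26T04:18:44Z (reconciler: no traction for 8.3 d (last activity item-evidence-added at 2026-08-17T19:24:59Z); parked, not closed — `ledger route dormant route-CriticalPhenomena-SAWExcursionCardy --off` to reactivate) — unstaffed, not closed; items shared with open routes are served there. `ledger route dormant <id> --off` reactivates.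

# Route SAWExcursionCardy — A Cardy–Fomin formula for the SAW — the SAW × random-walk-excursion
non-intersection probability tends to F(η)=(8/5)η₂F₁(−1/2,2;7/2;η); martingale identification with
two auxiliary marked points

It suffices to show X_EC = (N) ∧ (S) ∧ (T), processed by the identification theorem (I′) [route
realising idea card
saw-rw-cardy-formula — "a Cardy formula for the SAW"]:
 (N) SlitExcursionCardy — the CARDY–FOMIN FORMULA FOR THE SAW in martingale-ready form. Observable:
N_δ = P[γ ∩ ω = ∅], γ the
critical square-lattice SAW (law Literature.Probability.RandomPlanarGeometry.SAW.law, weight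
x_c^|γ|) from a_δ to b_δ in Ω_δ, ω an
INDEPENDENT simple-random-walk excursion of Ω_δ from c_δ to d_δ (c, d on one boundary arc; typed
through
Literature.Probability.LatticeModels.SRW.pathLaw: the walk from c_δ killed at its first non-Ω_δ
step, conditioned to be killed right
after visiting d_δ). Claim: conditionally on any initial segment η of the SAW (tip v), N_δ(η) =
h_S(η) · F(u_η) + o(1) UNIFORMLY over
ρ-separated prefixes, where h_S = P[excursion avoids η∖{v}] (an explicit random-walk quantity), u_η²
= Λ_η =
G(v,d)G(c,b)/(G(v,c)G(d,b)) is the RANDOM-WALK CROSS-RATIO of (tip, c, d, b) built from symmetric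
killed-walk Green functions of the
slit graph Ω_δ∖(η∖{v}) (no conformal map in the statement: local lattice factors cancel,
KozdronLawler2005 Thm 1.1), and
 F(u) = (8/5)·u·₂F₁(−1/2, 2; 7/2; u) = 6u∫₀¹ t√((1−t)(1−ut))dt,
the bounded solution of 2u²(1−u)F″ + u(3−u)F′ − 3(1−u)F = 0 with F(1) = 1 (Gauss: ₂F₁(−1/2,2;7/2;1)
= 5/8) — the κ = 8/3 member
of the family whose κ = 2 member φ(u) = u(2−u) is Kozdron's "Fomin identity for SLE₂"
(Kozdron2007Fomin Thm 6.1). Its prefix-free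
case on conformal rectangles R = (Ω; a, c, d, b) is the headline crux ExcursionCardyFormula: N_δ →
F(crossRatio x) for every
uniformizing datum — literally
Literature.Probability.RandomPlanarGeometry.ConformalRectangle.HasCrossingLimit with Cardy's
cross-ratio η = (x₀−x₁)(x₂−x₃)/((x₀−x₂)(x₁−x₃)) of the library (the SAW joins pt 0 to pt 3, the
excursion pt 1 to pt 2).
 (S) SimpleSubseqLimits — every subsequential weak limit of the SAW laws is carried by simple curves
meeting ∂Ω only at a, b.
 (T) EventualTight — eventual tightness
(Literature.Probability.RandomPlanarGeometry.IsTightAlongMesh; shared item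
stmt-CriticalPhenomena-1881, NOT the refuted all-δ stmt-CriticalPhenomena-0772).
 (I′) DrivingIdentification := SlitExcursionCardy → SimpleSubseqLimits → SubseqIdentification: for a
subsequential limit μ, Loewner-
parametrise (simple curves), observe that t ↦ [H_{Ω∖γ[0,t]}(c,d)/H_Ω(c,d)]·F(u_t) is a bounded
martingale (exact lattice martingale
P[ω∩γ=∅ | γ[0,n]] + (N) + KozdronLawler2005), expand at far marked points c = py, d = qy, y → ∞:
order y⁻¹ gives W_t martingale, order
y⁻² gives ⟨W⟩_t = κ̂t with κ̂(u) = −2[u(1+u)F′ − (1−u)F]/(u²[(1−u)F″/2 − F′]) ≡ 8/3 for this F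
(checked symbolically and numerically);
Lévy + the tree's PROVED isSLELaw_of_isLocalMartingale_driving_of_lt_four (κ = 8/3 < 4, no
named-fact input) give IsSLELaw (8/3).
Then SubseqIdentification + (T) + the PROVED criterion
Literature.Probability.RandomPlanarGeometry.convergesInLawToSLE_of_isTightAlongMesh
(with IsSLECurve.map_eq_holds) give Literature.Probability.RandomPlanarGeometry.SAW.SAWScalingLimit
= SAWScalingLimit. No unproved
Literature fact sits in the assembly cone.
Lean: `∀ (R : Literature.Probability.RandomPlanarGeometry.ConformalRectangle) (a b c d : ℝ →
Literature.Probability.LatticeModels.Site 2),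
Literature.Probability.RandomPlanarGeometry.SAW.IsEndpointApprox (R.chord 0 3 (by decide)) a b →
Filter.Tendsto (fun δ => Literature.Probability.LatticeModels.meshPoint δ (c δ)) (nhdsWithin 0
(Set.Ioi 0)) (nhds (R.pt 1)) → Filter.Tendsto (fun δ =>
Literature.Probability.LatticeModels.meshPoint δ (d δ)) (nhdsWithin 0 (Set.Ioi 0)) (nhds (R.pt 2)) →
(∀ᶠ δ in nhdsWithin 0 (Set.Ioi 0), c δ ∈ Literature.Probability.LatticeModels.meshBoundary R.carrier
δ ∧ d δ ∈ Literature.Probability.LatticeModels.meshBoundary R.carrier δ) → let E : ℝ → Set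
(Literature.Probability.LatticeModels.Site 2) → ℝ := fun δ A =>
(Literature.Probability.LatticeModels.SRW.pathLaw 2).real {ω | ∃ n : ℕ, (∀ j < n,
(Literature.Probability.LatticeModels.discreteDomainGraph R.carrier δ).Adj (c δ +
Literature.Probability.LatticeModels.SRW.S ω j) (c δ + Literature.Probability.LatticeModels.SRW.S ω
(j + 1))) ∧ ¬ (Literature.Probability.LatticeModels.discreteDomainGraph R.carrier δ).Adj (c δ +
Literature.Probability.LatticeModels.SRW.S ω n) (c δ + Literature.Probability.LatticeModels.SRW.S ω
(n + 1)) ∧ c δ + Literature.Probability.LatticeModels.SRW.S ω n = d δ ∧ ∀ j ≤ n, c δ +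
Literature.Probability.LatticeModels.SRW.S ω j ∉ A}; let N : ℝ → ℝ := fun δ => ∫ γ, E δ {v | v ∈
γ.walk.support} / E δ ∅ ∂(Literature.Probability.RandomPlanarGeometry.SAW.law R.carrier δ (a δ) (b
δ)); let F : ℝ → ℝ := fun u => (8 / 5 : ℝ) * u * ₂F₁ (-1 / 2 : ℝ) (2 : ℝ) (7 / 2 : ℝ) u;
R.HasCrossingLimit N F`
(the headline crux ExcursionCardyFormula; X_EC itself is the conjunction of the route decls
SlitExcursionCardy ∧ SimpleSubseqLimits ∧ EventualTight, and Assembly := ExcursionCardyFormula →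
SlitExcursionCardy → DrivingIdentification → SimpleSubseqLimits → EventualTight → SAWScalingLimit;
every decl elaborates, planner Sketch.lean rc = 0)

## Assembly
DrivingIdentification applied to SlitExcursionCardy and SimpleSubseqLimits yields
SubseqIdentification; for each (D, a, b) with
IsEndpointApprox the SAW laws are probability measures for all small δ (IsEndpointApprox.reachable ⇒
weight univ ≠ 0; finitely many
SAWs in bounded Ω_δ ⇒ < ∞), so replace SAW.law by a family of probability measures agreeing with it
eventually (ConvergesInLawToSLE,
IsTightAlongMesh and the subsequential-limit hypothesis only see the germ at 0+), apply the PROVED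
Literature.Probability.RandomPlanarGeometry.convergesInLawToSLE_of_isTightAlongMesh with huniq :=
IsSLECurve.map_eq_holds, hY :=
eventually SAW.aemeasurable_curve, hT := EventualTight, hL := SubseqIdentification read through
IsSubseqLimitLaw, and unfold
SAWScalingLimit. ExcursionCardyFormula is carried as the (logically redundant, η = nil) headline
hypothesis.

Rationale: WHY THIS LINE. Every proved interface ⇒ SLE theorem rests on a discrete observable that is the
probability of a macroscopic event, (nearly) harmonic in a
marked point, with a conformally invariant limit (Smirnov2001 / Cardy1992 crossing formula;
LawlerSchrammWerner2004 LERW, where the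
observables are random-walk hitting functionals of the slit domain; CDHKSCRAS2014,
DuminilCopinSmirnov2012Clay Prop. 6.7). For the SAW the
only candidate in print is the parafermion (route SAWParafermion, DuminilCopinSmirnov2012 Conj. 2),
which needs a boundary normalisation
carrying lattice factors (KennedyLawler2013) and has no ℤ² vertex relation. This line replaces it by
the SAW × random-walk-excursion
NON-INTERSECTION probability with two auxiliary marked points: exactly N_δ =
E_γ[H_{Ω_δ∖γ}(c,d)/H_{Ω_δ}(c,d)], an average of EXACTLY
discrete-harmonic functions of c, a probability (so no local lattice factor can survive), whose
continuum value is pinned by a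
level-two ODE we solved in closed form — the κ = 8/3 analogue of Fomin's identity (Fomin2001: for
LERW × RW the same non-intersection
probability is an exact determinant on the lattice; Kozdron2007Fomin: its scaling limit u(2−u) by
the very martingale used here).
Imported areas: discrete potential theory uniform over simply connected lattice domains
(KozdronLawler2005 Thm 1.1: excursion Poisson
kernel = local × local × conformal invariant), which makes the slit statement LATTICE-INTRINSIC
through a Green-function cross-ratio;
SLE/BPZ calculus (LawlerSchrammWerner2003Restriction, Werner2004Girsanov; fusion h_{1,2} × h_{2,3} →
h_{2,4} = 21/8 gives the integer
coalescence exponent 1 = the regular Frobenius exponent of F); the Kemppainen–Smirnov / CDHKS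
identification pipeline already vendored
in the tree for FK-Ising (ObservableDrivingMartingales, ObservableLimitPassage,
SLELawOfDrivingProcessLocal). What it does that prior
routes do not: an observable route on ℤ² with an explicit, typed target function and NO
boundary-normalisation, whose assembly cone is
free of unproved named facts; it shares precompactness (EventualTight) and identification
(SubseqIdentification) nodes with
SAWLeftRightFKG / SAWParafermion instead of re-filing them, and steers around the negatives index
(stmt-CriticalPhenomena-0772) by using
only eventual tightness.

RANKED CRUXES. #2 ExcursionCardyFormula (crux) — (card r2) THE CARDY–FOMIN FORMULA FOR THE SAW: for
every conformal rectangle R = (Ω; a, c, d, b) (marked in this cyclic order: pt 0 = a, pt 1 = c, pt 2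
= d, pt 3 = b), every endpoint approximation (a_δ, b_δ) of the Dobrushin domain R.chord 0 3 = (Ω; a,
b) (SAW.IsEndpointApprox) and all boundary vertices c_δ, d_δ ∈ meshBoundary Ω δ with δc_δ → c, δd_δ
→ d, the non-intersection probability N_δ = ∫ E_δ(γ)/E_δ(∅) dSAW.law (E_δ(A) = probability that SRW
from c_δ stays on Ω_δ-edges, avoids A, visits d_δ and is killed at the next step) satisfies
R.HasCrossingLimit N F with F(u) = (8/5)u₂F₁(−1/2,2;7/2;u): N_δ → F(crossRatio x) for every
uniformizing datum (φ, x). Both arcs are covered (swap a ↔ b: reversal symmetry of x_c^|γ| and of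
the excursion). [difficulty: open-problem] (why it might fail: It IS conformal invariance of a SAW
functional with no lattice identity behind it (Fomin's determinant exists only for LERW, κ=2); as
typed it could also fail if the limit saw HOW c_δ,d_δ sit in ∂Ω_δ — the local RW factors
(KozdronLawler2005 Thm 1.1) must cancel in E_δ(γ)/E_δ(∅).) [LawlerSchrammWerner2004SAW,
Kozdron2007Fomin, Fomin2001, KozdronLawler2005, LawlerSchrammWerner2003Restriction, Smirnov2001,
Summits/CriticalPhenomena/SAWScalingLimit/Ideas/saw-rw-cardy-formula.md]
#3 SlitExcursionCardy (crux) — (card r3, martingale-ready and lattice-intrinsic) for R, a_δ, b_δ,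
c_δ, d_δ as in ExcursionCardyFormula, every ε, ρ > 0 and all small δ: for EVERY self-avoiding prefix
η of positive SAW.law-probability from a_δ to a tip v whose vertices stay ρ-away from δc_δ, δd_δ,
δb_δ, with S = η∖{v}, G_η = Ω_δ minus S, and c_δ joined to b_δ in G_η: |N_δ(η) − h_S·F(min(1,√Λ_η))|
≤ ε, where N_δ(η) = P[ω ∩ γ = ∅ | γ extends η] (conditional SAW.law average of E_δ(γ)/E_δ(∅)), h_S =
E_δ(S)/E_δ(∅) = P[the excursion avoids the past], and Λ_η = G(v,d_δ)G(c_δ,b_δ)/(G(v,c_δ)G(d_δ,b_δ))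
with G the (symmetric) Green function of SRW on G_η killed at its first non-G_η step — the
random-walk cross-ratio, → u² by KozdronLawler2005. Exact identity behind it: N_δ(η) = h_S · Ñ(G_η;
v, b_δ; c_δ, d_δ) (restriction of the excursion measure + domain Markov of x_c^|γ|), so the content
is Ñ → F uniformly over slit domains. [deps: ExcursionCardyFormula] [difficulty: open-problem] (why
it might fail: Uniformity over ALL ρ-separated prefixes is stronger than the conjunct: lattice-scale
necks cut by the past, or an interior a_δ (IsEndpointApprox allows it; Ω_δ∖η is then doubly
connected at scale dist(a_δ,∂Ω)), may leave O(1) gaps between N_δ(η)/h_S and F(√Λ_η) that vanish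
only in probability.) [KemppainenSmirnov2017, KozdronLawler2005, LawlerSchrammWerner2004,
Kozdron2007Fomin, DuminilCopinSmirnov2012Clay, LawlerSchrammWerner2004SAW]
#4 DrivingIdentification (crux) — (card r3, identification half) SlitExcursionCardy →
SimpleSubseqLimits → SubseqIdentification. Proof plan = the CDHKS/LSW martingale-observable pipeline
for THIS observable: (i) subsequential limit μ carried by simple chords ⇒ Loewner parametrisation
through a chordal uniformizer with continuous driving process W (Lawler Prop. 4.4, tree
LoewnerSlitTheorem/SlitLoewnerChain) and W^δ → W along the SAW; (ii) the exact bounded lattice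
martingale n ↦ P[ω∩γ=∅ | γ[0,n]] = h^δ_n · N_δ(γ[0,n]) and SlitExcursionCardy + KozdronLawler2005
(√Λ → conformal cross-ratio, uniformly over slit domains) make t ↦
g_t′(c)g_t′(d)((d−c)/(g_t(d)−g_t(c)))²·F((g_t(c)−W_t)/(g_t(d)−W_t)) a martingale for μ (passage as
in tree ObservableLimitPassage); (iii) far-field expansion at c = py, d = qy, y → ∞ (tree
ObservableDrivingMartingales pattern, needs sup|W| ∈ L³): W_t and W_t² − κ̂t martingales with
κ̂(p/q) = −2[u(1+u)F′−(1−u)F]/(u²[(1−u)F″/2−F′]) = 8/3 identically; (iv) tree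
isSLELaw_of_isLocalMartingale_driving_of_lt_four (PROVED; Lévy = levy_characterisation_holds) ⇒
IsSLELaw (8/3) D μ. [deps: SlitExcursionCardy, SimpleSubseqLimits, SubseqIdentification]
[difficulty: XL] (why it might fail: Typed hypotheses may be too weak for the passage:
driving-function convergence along the SAW must come from convergence to SIMPLE limits alone, the RW
cross-ratio → conformal cross-ratio is needed uniformly in slit domains (KozdronLawler2005-type,
unvendored), and sup|W| needs L³ tails.) [LawlerSchrammWerner2004, CDHKSCRAS2014,
DuminilCopinSmirnov2012Clay, KemppainenSmirnov2017, KozdronLawler2005,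
Literature.Probability.RandomPlanarGeometry.isSLELaw_of_isLocalMartingale_driving_of_lt_four,
Literature.Probability.RandomPlanarGeometry.Loewner.martingale_driver_of_fkObservable]
#5 SimpleSubseqLimits (crux) — (card r4, regularity half; subsequential form of
SAWConfRestriction.SimpleOfLimit stmt-CriticalPhenomena-0774, which asks it only for a FULL limit)
for every Dobrushin domain, endpoint approximation, mesh sequence s_n → 0+ and probability measure μ
on CurveClass ℂ that is the weak limit of the SAW laws along s_n: μ-a.e. curve is simple and meets
∂Ω only at a, b. This is what makes subsequential limits Loewner-parametrisable for
DrivingIdentification; it is implied by the conjunct (SLE_{8/3} is a simple chord) and is the target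
of idea card brownian-domination-simple-limits. [difficulty: open-problem] (why it might fail: Weak
limits of simple polylines need not be simple: needs uniform no-macroscopic-self-touching and
no-boundary-crawling bounds for the x_c-SAW under EVERY endpoint approximation (interior a_δ
included); only sub-ballisticity is in print, LSW04 p.14 argue simplicity heuristically.)
[LawlerSchrammWerner2004SAW, KennedyLawler2013, DuminilCopinHammond2013,
Summits/CriticalPhenomena/SAWScalingLimit/Ideas/brownian-domination-simple-limits.md,
stmt-CriticalPhenomena-0774]
#6 EventualTight (crux) — (card r4, precompactness half; verbatim the shared item
stmt-CriticalPhenomena-1881 of route SAWLeftRightFKG, support there, crux here because nothing in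
this line implies it) for every Dobrushin domain and endpoint approximation, IsTightAlongMesh of the
SAW curve laws — the eventual, event-level repair of the refuted all-δ Tight
(stmt-CriticalPhenomena-0772). [difficulty: open-problem] (why it might fail: Open for SAW: no RSW /
annulus-crossing bound at x_c (KemppainenSmirnov2017 §4 covers FKG models only; route
SAWLeftRightFKG bets on a left–right FKG); the all-δ form stmt-CriticalPhenomena-0772 is refuted and
only sub-ballisticity is unconditional.) [KemppainenSmirnov2017, AizenmanBurchardDuke1999,
DuminilCopinHammond2013,
Summit.CriticalPhenomena.SAWScalingLimit.Theorems.SAWParafermionTight_refuted,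
stmt-CriticalPhenomena-1881]
#9 SubseqIdentification (support) — (verbatim the shared item stmt-CriticalPhenomena-0783 of routes
SAWParafermion / SAWLeftRightFKG) every subsequential weak limit of the SAW laws is the chordal
SLE_{8/3} law. In THIS route it is the OUTPUT node of SlitExcursionCardy + SimpleSubseqLimits
through DrivingIdentification, kept as the junction other routes also feed; support, not staffed
from here. [difficulty: open-problem] [LawlerSchrammWerner2004SAW,
LawlerSchrammWerner2003Restriction, stmt-CriticalPhenomena-0783]
#9 RWGreenCrossRatioLimit (support) — (random-walk side, provable from print) for R, approximations
as in ExcursionCardyFormula (a_δ, b_δ any endpoint approximation, c_δ, d_δ boundary vertices) and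
every uniformizing datum (φ, x): the random-walk cross-ratio √Λ_δ, Λ_δ =
G(a_δ,d_δ)G(c_δ,b_δ)/(G(a_δ,c_δ)G(d_δ,b_δ)) with G the Green function of SRW on Ω_δ killed at its
first non-Ω_δ step, tends to crossRatio x. Mechanism: KozdronLawler2005 Thm 1.1/1.2 (uniformly over
simply connected lattice domains, excursion kernel and Green function factor as
local(x)·local(y)·conformal part; in the 4-ratio every point occurs once up and once down, so local
parts cancel) + boundary Harnack for the possibly interior a_δ, b_δ. The η = nil instance of what
DrivingIdentification needs in slit domains; with SlitExcursionCardy (η = nil) it re-derives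
ExcursionCardyFormula. [difficulty: L] [KozdronLawler2005, Lawler2005, LawlerSchrammWerner2004]
#9 CardyFSpec (support) — (calculus, provable now) the target function F(u) =
(8/5)u₂F₁(−1/2,2;7/2;u) solves 2u²(1−u)F″ + u(3−u)F′ − 3(1−u)F = 0 on (0,1) (the κ = 8/3 case of
(κ/2)(1−u)²F″ + [2/u − 2u − κ(1−u)]F′ − 2(1−u)²F/u² = 0, the drift condition of the martingale of
DrivingIdentification; κ = 2 gives Kozdron's u(2−u)), F(1) = 1 (Gauss summation:
Γ(7/2)Γ(2)/(Γ(4)Γ(3/2)) = 5/8), F(u)/u → 8/5 at 0 (regular Frobenius exponent 1 = h_{2,4} − h_{1,2}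
− h_{2,3} = 21/8 − 5/8 − 1; the other exponent is −3/2), F strictly increasing on [0,1], and the
Euler integral F(u) = 6u∫₀¹ t√((1−t)(1−ut)) dt. Fixes the normalisation every other item uses.
[difficulty: provable-now] [Kozdron2007Fomin, LawlerSchrammWerner2003Restriction,
LawlerSchrammWerner2001]

TWO-LAYER PLAN. Foreseen glued splits (filed only after a crux closes or stalls with a census):
DrivingIdentification ⇐ FarFieldMartingales (the
ObservableDrivingMartingales analogue: if the stopped far-field excursion observables are
martingales then W_t, W_t² − (8/3)t are) →
ObservablePassage (ObservableLimitPassage analogue: lattice martingale + SlitExcursionCardy + W^δ →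
W ⇒ continuum martingale) →
LoewnerOfSimpleLimits (SimpleSubseqLimits ⇒ driving process + convergence of driving functions) →
DrivingIdentification.
SlitExcursionCardy ⇐ SlitExcursionCardyInProbability (same estimate off an event of
SAW.law-probability ≤ ε) → NoNeckEstimate (ρ-separated
prefixes create no lattice-scale necks with probability → 1) → SlitExcursionCardy.
ExcursionCardyFormula ⇐ RWside (RWGreenCrossRatioLimit +
KozdronLawler2005 ratio convergence for fixed macroscopic hulls) → SAWside (existence and
cross-ratio dependence of lim E[h(γ)]) → ExcursionCardyFormula.

KILL CRITERIA. ¬ExcursionCardyFormula (the limit exists but is not F(η), or depends on the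
approximation) closes the route (close --reason
refuted:ExcursionCardyFormula) — it is the cheapest decisive test and is lattice-intrinsic through
RWGreenCrossRatioLimit.
¬SlitExcursionCardy with ExcursionCardyFormula intact forces the restate to the in-probability form
(tenure --restate, see Two-layer
plan), not a close. DrivingIdentification refuted as typed ⇒ restate with the missing hypothesis
named by the refuter (it is a theorem
schema, not a conjecture about the SAW). ¬SimpleSubseqLimits or ¬EventualTight for some endpoint
approximation refutes the conjunct
SAWScalingLimit for that approximation (all routes die together; record in the negatives index).
SubseqIdentification proved elsewhere
(restriction or parafermion routes) moots r2–r5 and leaves only EventualTight.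

NOT DECOMPOSED YET. Everything inside DrivingIdentification (far-field algebra, optional stopping at
capacity steps, L³ tails of sup|W| à la
KemppainenSmirnov2017 Prop. 3.8, convergence of driving functions for simple limits) — layer-2
children later; the RW potential theory
in slit domains beyond the η = nil support item (KozdronLawler2005 is uniform over simply connected
lattice domains, so it is expected to
be vendoring work, not a crux); any attack on ExcursionCardyFormula itself (the card offers none
beyond the exact harmonicity in c of the
γ-wise factor and the integer coalescence exponent; a Poisson-equation-in-c approach with Riesz mass
= SAW first-touch density is an idea,
not an item); endpoint conventions (exit-at-d vs boundary Poisson kernel) — deliberately fixed to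
the simplest typed one.

CHEAPEST FALSIFIER. Lattice-intrinsic small-box test of SlitExcursionCardy at η = nil: on L × L
boxes (L = 5…9, a, b opposite corners, c, d on one side)
enumerate x_c-weighted corner-to-corner SAWs exactly (μ ∈ [2.6, 2.7] is in tree; use x_c = 0.37905),
compute N_L exactly (the RW part
is a linear solve per γ-class, or Monte-Carlo over γ), compute Λ_L from the killed-walk Green
functions of the same box (one linear
solve), and tabulate N_L − F(√Λ_L): a drift AWAY from 0 with L kills r2/r3; no conformal map is
needed anywhere. Planner's run at toy size (pure Python, exact): L = 4 (5×5 vertices, 8512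
corner-to-corner SAWs) gives N/F(√Λ) = 0.69, 0.83, 0.82, 0.71 at √Λ = 0.20, 0.44, 0.52, 0.61 and
0.39 at √Λ = 0.05; L = 5 (6×6 vertices, 1 262 816 SAWs) gives 0.80, 0.84, 0.89, 0.92 at √Λ = 0.42,
0.29, 0.62, 0.54 (0.72 at 0.11, 0.41 at 0.03); L = 3 gives 0.67–0.76 — commensurable, correctly
ordered in u, rising with L, and far too small to judge (the walk fills the box): L ≳ 30 by
Monte-Carlo over γ is the real test. Continuum sanity
(done by the planner): F solves the κ-family ODE with κ̂(u) = 2.666667 at u = 0.1,…,0.9, F(1) =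
1.00000005, F(u)/u → 1.6, and the κ = 2
member reproduces Kozdron's u(2−u).

NUMBERS. F(u) = (8/5)u₂F₁(−1/2,2;7/2;u): F(0.1) = 0.15535, F(0.3) = 0.43654, F(0.5) = 0.67387,
F(0.7) = 0.85936, F(0.9) = 0.97798, F(1) = 1;
F′(0⁺) = 8/5; exponents {1, −3/2} at 0, {0 (with log), 2} at 1, {−1, 3/2} at ∞ (Riemann P-symbol;
hypergeometric a = 1 − 4/κ = −1/2,
b = 2, c = 2 + 4/κ = 7/2). General κ: F_κ = u₂F₁(1−4/κ,2;2+4/κ;u)/₂F₁(…;1). ξ̃(5/8,1) = 21/8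
(LawlerSchrammWerner2001), h_{1,2} = 5/8,
h_{2,3} = 1, h_{2,4} = 21/8, h_{1,3} = 2 at c = 0. x_c(ℤ²) = 1/μ, μ ∈ [2.6, 2.7] (tree), numerically
0.3790523.
RW-side check of RWGreenCrossRatioLimit on the square (planner, pure Python: Jacobi sn boundary
correspondence vs Gauss–Seidel Green functions on the (L+1)² box, a, b opposite corners): √Λ_L/η =
1.142, 0.801, 1.194 (L = 4) → 0.998, 0.851, 1.083 (L = 8) → 0.992, 0.912, 1.043 (L = 16) → 0.997,
0.952, 1.024 (L = 32) for η = 0.1716, 0.6503, 0.5137; the corner-adjacent configuration η = 0.0115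
converges slowest (4.62, 2.28, 1.50, 1.24) — local factors at a CORNER start cancel only
asymptotically.

DEFINITION REQUESTS. (i) Literature/Probability/LatticeModels: `SRW.killedGreen Gr p q` (Green
function of SRW run on the edges of a subgraph Gr of ℤ² and
killed at its first non-Gr step) and `SRW.exitAfterAvoiding Gr p q A` (the excursion functional E
used above) — both are inlined `let`s
now; (ii) Summits/CriticalPhenomena/SAWScalingLimit/Theorems: `SAW.excursionAvoidance` (the
observable N_δ, plain and conditional) and
`sawExcursionF` (F). Filed with `ledger workitem add --kind definition` after open so later
signatures shrink.

Novelty: Searches (2026-08-15; local searchd DOWN, arXiv/OpenAlex/S2 rate-limited, galaxy saturated — zbMATH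
+ Crossref used): zbmath
"Kozdron Fomin identity scaling limit two paths" (2 rows: arXiv:math/0703615, arXiv:math/0605159),
zbmath "Kozdron Lawler estimates of
random walk exit probabilities" (1 row: doi:10.1214/ejp.v10-294), crossref "probability that SLE and
Brownian excursion do not intersect
kappa hypergeometric" (12 rows, none relevant beyond Werner–Wu), crossref "Kozdron scaling limit
Fomin's identity …" (Alberts–Kozdron
doi:10.1214/ecp.v13-1399, KozdronLawler2007), zbmath "SLE 8/3 Brownian excursion non-intersection …
Fomin" (0 rows); READ:
arXiv:math/0703615 pp. 10–12 (Thm 6.1, Cor. 6.3: κ = 2, same martingale J_t H̃*(X_t,Y_t), ODE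
u²(1−u)²φ″ + 2u(1−u)φ′ − 2(1−u)²φ = 0 =
our family at κ = 2), arXiv:math/0501189 p. 3 (Thm 1.1); plus the card's own audit trail
(Werner2004Girsanov §3–4, LawlerSchrammWerner2003Restriction,
Lawler2005 Ch. 9, arXiv:1109.3091, arXiv:1212.6215, arXiv:0708.0032, Duplantier 1999, Kennedy 2004).
ADDENDUM 2026-08-16 (route-choice planner, after the gen-3 novelty audit): READ arXiv:0905.2430 =
Kozdron2009 (J. Phys. A 42:265003) p. 12, Theorem 8.1 + Remark.
Nearest prior art found: Kozdron2009 (arXiv:0905.2430) Thm 8.1 — for chordal SLE_κ (0 < κ ≤ 4) from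
0 to ∞ in ℍ and an independent Brownian excursion from x to y, P[γ ∩ β = ∅] =
[Γ(2a)Γ(4a+1)/(Γ(2a+2)Γ(4a−1))]·u·₂F₁(2, 1−2a; 2a+2; u), a = 2/κ, u = x/y, by the same
Itô/Riemann-P-function computatio  [refs: 10.1214/ejp.v10-294, 10.1214/ecp.v13-1399, math/0703615, math/0605159, math/0501189, 1109.3091, 1212.6215, 0708.0032, 0905.2430, doi:10.1214/ejp.v10-294, doi:10.1214/ecp.v13-1399, KozdronLawler2007, Lawler2005, Kozdron2009, Fomin2001, LawlerSchrammWerner2004, KozdronLawler2005]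

Barriers (technique_class: non-intersection-observable, martingale-identification): - technique_class: non-intersection-observable, martingale-identification
- Literature.Barriers.CriticalPhenomena.NienhuisWeightsExcludeVertexSAW: evaded — no exact local
linear relation for a ℤ² SAW observable is claimed or needed; the only exact identities used are
discrete harmonicity of the RANDOM-WALK factor for each fixed SAW, the restriction property of the
excursion measure and the domain Markov property of x_c^|γ| (all theorems); the price is that
ExcursionCardyFormula has no integrable engine (honest residue).
- Literature.Barriers.CriticalPhenomena.ParafermionicHalfCauchyRiemann: not in its class — N_δ is
not built from vertex relations + boundary values (whose discrete problem is non-unique); its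
c-dependence is an average of genuinely discrete-harmonic functions, sub-harmonic in c with Riesz
mass = SAW first-touch density.
- Literature.Barriers.CriticalPhenomena.EmbeddingModulusUniqueness: evaded the way LERW evades it —
the reference object (SRW excursion, killed-walk Green functions) sees the embedding; on a sheared
lattice Λ_δ converges to the sheared domain's modulus and F∘√Λ stays the right prediction only if
the SAW follows the walk, which is exactly the content of r2 (cf. card random-walk-ruler-needs-d4:
an RW ruler is not structural, so r2 genuinely spends the symmetry of ℤ²).
- Literature.Barriers.CriticalPhenomena.SmirnovTriangularOnly: not applicable — no colour switching
or lattice-specific cancellation; ℤ² only supplies harmonic functions.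
- Literatu

Novelty grade: new-combination — gen-3 route-review (2026-08-15). Route's Novelty says the κ=8/3 target F=(8/5)u₂F₁(−1/2,2;7/2;u) was 'solved in closed form' here, nearest art Kozdron2007Fomin (κ=2), crossref query on SLE×excursion non-intersection 'none relevant'. MISSED (held: paper:arxiv-0905.2430): Kozdron 2009, J.Phys.A 42:265 (refuter refuter-rreview-route-CriticalPhenomena--61058af5-g3-0, 2026-08-15T14:30:11Z; prior: arXiv:0905.2430 (Kozdron 2009 J.Phys.A 42:265003, Thm 8.1 + Remark), arXiv:math/0703615 (Kozdron2007Fomin Thm 6.1), LawlerSchrammWerner2004SAW, LawlerSchrammWerner2003Restriction, KemppainenSmirnov2017, KozdronLawler2005, Kozdron ALEA 2 (2006) SRW excursion scaling limit)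

History (route lifecycle, newest last):
- 2026-08-15T11:40:04Z · rev 1: restated DrivingIdentification (stmt-CriticalPhenomena-4513) — render-order fix: DrivingIdentification (rank 4) referenced SimpleSubseqLimits (rank 5) and SubseqIdentification (support) which the gate renders later, so it a (planner-plancard-CriticalPhenomena-SAWScaling-7b10c223-0)
- 2026-08-15T11:41:35Z · rev 2: restated Assembly (stmt-CriticalPhenomena-4517) — re-file the assembly now that DrivingIdentification is rendered (emitted as TODO at open because of render order); hypotheses reordered (regularity before the i (planner-plancard-CriticalPhenomena-SAWScaling-7b10c223-0)
- 2026-08-26T04:18:44Z · DORMANT — reconciler: no traction for 8.3 d (last activity item-evidence-added at 2026-08-17T19:24:59Z); parked, not closed — `ledger route dormant route-CriticalPhenomen (operator:999:1997407)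

sub-problem: SAWScalingLimit · status: dormant · opened planner-plancard-CriticalPhenomena-SAWScaling-7b10c223-0 2026-08-15T11:34:24Z · rev 11 · ledger route-CriticalPhenomena-SAWExcursionCardy
GENERATED by the gate from the ledger (D-0016/17). Provers cite these decls: `theorem foo : Summit.CriticalPhenomena.SAWScalingLimit.Theses.SAWExcursionCardy.<Decl> := …` in Summits/CriticalPhenomena/SAWScalingLimit/Theorems/<Name>.lean.
-/

namespace Summit.CriticalPhenomena.SAWScalingLimit.Theses.SAWExcursionCardy

open scoped BigOperators Topology Manifold Classical MeasureTheory ProbabilityTheory Matrix InnerProductSpace ComplexConjugate ContinuousMap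
open Filter Set Function TopologicalSpace MeasureTheory

attribute [summit_statement] _root_.SAWScalingLimit

/-- item stmt-CriticalPhenomena-4511 · crux · rank 2 · open · by planner
why it might fail: It IS conformal invariance of a SAW functional with no lattice identity behind it (Fomin's determinant exists only for LERW, κ=2); as typed it could also fail if the limit saw HOW c_δ,d_δ sit in ∂Ω_δ — the local RW factors (KozdronLawler2005 Thm 1.1) must cancel in E_δ(γ)/E_δ(∅).
sources: LawlerSchrammWerner2004SAW, Kozdron2007Fomin, Fomin2001, KozdronLawler2005, LawlerSchrammWerner2003Restriction, Smirnov2001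
[crux] (card r2) THE CARDY–FOMIN FORMULA FOR THE SAW: for every conformal rectangle R = (Ω; a, c, d,
b) (marked in this cyclic order: pt 0 = a, pt 1 = c, pt 2 = d, pt 3 = b), every endpoint
approximation (a_δ, b_δ) of the Dobrushin domain R.chord 0 3 = (Ω; a, b) (SAW.IsEndpointApprox) and
all boundary vertices c_δ, d_δ ∈ meshBoundary Ω δ with δc_δ → c, δd_δ → d, the non-intersection
probability N_δ = ∫ E_δ(γ)/E_δ(∅) dSAW.law (E_δ(A) = probability that SRW from c_δ stays on
Ω_δ-edges, avoids A, visits d_δ and is killed at the next step) satisfies R.HasCrossingLimit N F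
with F(u) = (8/5)u₂F₁(−1/2,2;7/2;u): N_δ → F(crossRatio x) for every uniformizing datum (φ, x). Both
arcs are covered (swap a ↔ b: reversal symmetry of x_c^|γ| and of the excursion). [difficulty:
open-problem] -/
@[route_item "route-CriticalPhenomena-SAWExcursionCardy", crux]
def ExcursionCardyFormula : Prop :=
  ∀ (R : Literature.Probability.RandomPlanarGeometry.ConformalRectangle) (a b c d : ℝ → Literature.Probability.LatticeModels.Site 2), Literature.Probability.RandomPlanarGeometry.SAW.IsEndpointApprox (R.chord 0 3 (by decide)) a b → Filter.Tendsto (fun δ => Literature.Probability.LatticeModels.meshPoint δ (c δ)) (nhdsWithin 0 (Set.Ioi 0)) (nhds (R.pt 1)) → Filter.Tendsto (fun δ => Literature.Probability.LatticeModels.meshPoint δ (d δ)) (nhdsWithin 0 (Set.Ioi 0)) (nhds (R.pt 2)) → (∀ᶠ δ in nhdsWithin 0 (Set.Ioi 0), c δ ∈ Literature.Probability.LatticeModels.meshBoundary R.carrier δ ∧ d δ ∈ Literature.Probability.LatticeModels.meshBoundary R.carrier δ) → let E : ℝ → Set (Literature.Probability.LatticeModels.Site 2) → ℝ := fun δ A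 => (Literature.Probability.LatticeModels.SRW.pathLaw 2).real {ω | ∃ n : ℕ, (∀ j < n, (Literature.Probability.LatticeModels.discreteDomainGraph R.carrier δ).Adj (c δ + Literature.Probability.LatticeModels.SRW.S ω j) (c δ + Literature.Probability.LatticeModels.SRW.S ω (j + 1))) ∧ ¬ (Literature.Probability.LatticeModels.discreteDomainGraph R.carrier δ).Adj (c δ + Literature.Probability.LatticeModels.SRW.S ω n) (c δ + Literature.Probability.LatticeModels.SRW.S ω (n + 1)) ∧ c δ + Literature.Probability.LatticeModels.SRW.S ω n = d δ ∧ ∀ j ≤ n, c δ + Literature.Probability.LatticeModels.SRW.S ω j ∉ A}; let N : ℝ → ℝ := fun δ => ∫ γ, E δ {v | v ∈ γ.walk.support} / E δ ∅ ∂(Literature.Probability.RandomPlanarGeometry.SAW.law R.carrier δ (a δ) (b δ)); let F : ℝ → ℝ := fun u => (8 / 5 : ℝ) * u * ₂F₁ (-1 / 2 : ℝ) (2 : ℝ) (7 / 2 : ℝ) u; R.HasCrossingLimit N F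

/-- item stmt-CriticalPhenomena-4512 · crux · rank 3 · open · by planner
why it might fail: Uniformity over ALL ρ-separated prefixes is stronger than the conjunct: lattice-scale necks cut by the past, or an interior a_δ (IsEndpointApprox allows it; Ω_δ∖η is then doubly connected at scale dist(a_δ,∂Ω)), may leave O(1) gaps between N_δ(η)/h_S and F(√Λ_η) that vanish only in probability.
sources: KemppainenSmirnov2017, KozdronLawler2005, LawlerSchrammWerner2004, Kozdron2007Fomin, DuminilCopinSmirnov2012Clay, LawlerSchrammWerner2004SAW
[crux] (card r3, martingale-ready and lattice-intrinsic) for R, a_δ, b_δ, c_δ, d_δ as in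
ExcursionCardyFormula, every ε, ρ > 0 and all small δ: for EVERY self-avoiding prefix η of positive
SAW.law-probability from a_δ to a tip v whose vertices stay ρ-away from δc_δ, δd_δ, δb_δ, with S =
η∖{v}, G_η = Ω_δ minus S, and c_δ joined to b_δ in G_η: |N_δ(η) − h_S·F(min(1,√Λ_η))| ≤ ε, where
N_δ(η) = P[ω ∩ γ = ∅ | γ extends η] (conditional SAW.law average of E_δ(γ)/E_δ(∅)), h_S =
E_δ(S)/E_δ(∅) = P[the excursion avoids the past], and Λ_η = G(v,d_δ)G(c_δ,b_δ)/(G(v,c_δ)G(d_δ,b_δ))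
with G the (symmetric) Green function of SRW on G_η killed at its first non-G_η step — the
random-walk cross-ratio, → u² by KozdronLawler2005. Exact identity behind it: N_δ(η) = h_S · Ñ(G_η;
v, b_δ; c_δ, d_δ) (restriction of the excursion measure + domain Markov of x_c^|γ|), so the content
is Ñ → F uniformly over slit domains. [deps: ExcursionCardyFormula] [difficulty: open-problem] -/
@[route_item "route-CriticalPhenomena-SAWExcursionCardy", crux]
def SlitExcursionCardy : Prop :=
  ∀ (R : Literature.Probability.RandomPlanarGeometry.ConformalRectangle) (a b c d : ℝ → Literature.Probability.LatticeModels.Site 2), Literature.Probability.RandomPlanarGeometry.SAW.IsEndpointApprox (R.chord 0 3 (by decide)) a b → Filter.Tendsto (fun δ => Literature.Probability.LatticeModels.meshPoint δ (c δ)) (nhdsWithin 0 (Set.Ioi 0)) (nhds (R.pt 1)) → Filter.Tendsto (fun δ => Literature.Probability.LatticeModels.meshPoint δ (d δ)) (nhdsWithin 0 (Set.Ioi 0)) (nhds (R.pt 2)) → (∀ᶠ δ in nhdsWithin 0 (Set.Ioi 0), c δ ∈ Literature.Probability.LatticeModels.meshBoundary R.carrier δ ∧ d δ ∈ Literature.Probability.LatticeModels.meshBoundary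 R.carrier δ) → let E : ℝ → SimpleGraph (Literature.Probability.LatticeModels.Site 2) → Literature.Probability.LatticeModels.Site 2 → Literature.Probability.LatticeModels.Site 2 → Set (Literature.Probability.LatticeModels.Site 2) → ℝ := fun δ Gr p q A => (Literature.Probability.LatticeModels.SRW.pathLaw 2).real {ω | ∃ n : ℕ, (∀ j < n, Gr.Adj (p + Literature.Probability.LatticeModels.SRW.S ω j) (p + Literature.Probability.LatticeModels.SRW.S ω (j + 1))) ∧ ¬ Gr.Adj (p + Literature.Probability.LatticeModels.SRW.S ω n) (p + Literature.Probability.LatticeModels.SRW.S ω (n + 1)) ∧ p + Literature.Probability.LatticeModels.SRW.S ω n = q ∧ ∀ j ≤ n, p + Literature.Probability.LatticeModels.SRW.S ω j ∉ A}; let Gf : SimpleGraph (Literature.Probability.LatticeModels.Site 2) → Literature.Probability.LatticeModels.Site 2 → Literature.Probability.LatticeModels.Site 2 → ℝ := fun Gr p q => ∑' n : ℕ, (Literature.Probability.LatticeModels.SRW.pathLaw 2).real {ω | (∀ j < n, Gr.Adj (p + Literature.Probability.LatticeModels.SRW.S ω j) (p + Literature.Probability.LatticeModels.SRW.S ω (j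 + 1))) ∧ p + Literature.Probability.LatticeModels.SRW.S ω n = q}; let F : ℝ → ℝ := fun u => (8 / 5 : ℝ) * u * ₂F₁ (-1 / 2 : ℝ) (2 : ℝ) (7 / 2 : ℝ) u; ∀ ε > (0 : ℝ), ∀ ρ > (0 : ℝ), ∀ᶠ δ in nhdsWithin 0 (Set.Ioi 0), ∀ (v : Literature.Probability.LatticeModels.Site 2) (η : (Literature.Probability.LatticeModels.discreteDomainGraph R.carrier δ).Walk (a δ) v), η.IsPath → (∀ w ∈ η.support, ρ ≤ dist (Literature.Probability.LatticeModels.meshPoint δ w) (Literature.Probability.LatticeModels.meshPoint δ (c δ)) ∧ ρ ≤ dist (Literature.Probability.LatticeModels.meshPoint δ w) (Literature.Probability.LatticeModels.meshPoint δ (d δ)) ∧ ρ ≤ dist (Literature.Probability.LatticeModels.meshPoint δ w) (Literature.Probability.LatticeModels.meshPoint δ (b δ))) → 0 < (Literature.Probability.RandomPlanarGeometry.SAW.law R.carrier δ (a δ) (b δ)).real {γ | ∃ q : (Literature.Probability.LatticeModels.discreteDomainGraph R.carrier δ).Walk v (b δ), γ.walk = η.append q} → let G := Literature.Probability.LatticeModels.discreteDomainGraph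 R.carrier δ; let S : Set (Literature.Probability.LatticeModels.Site 2) := {w | w ∈ η.support ∧ w ≠ v}; let Gη : SimpleGraph (Literature.Probability.LatticeModels.Site 2) := SimpleGraph.fromRel (fun x y => G.Adj x y ∧ x ∉ S ∧ y ∉ S); let X : Set (Literature.Probability.RandomPlanarGeometry.SAW.DomainSAW R.carrier δ (a δ) (b δ)) := {γ | ∃ q : G.Walk v (b δ), γ.walk = η.append q}; let condAvoid : ℝ := (∫ γ in X, E δ G (c δ) (d δ) {w | w ∈ γ.walk.support} ∂(Literature.Probability.RandomPlanarGeometry.SAW.law R.carrier δ (a δ) (b δ))) / (Literature.Probability.RandomPlanarGeometry.SAW.law R.carrier δ (a δ) (b δ)).real X / E δ G (c δ) (d δ) ∅; let hS : ℝ := E δ G (c δ) (d δ) S / E δ G (c δ) (d δ) ∅; let Λ : ℝ := Gf Gη v (d δ) * Gf Gη (c δ) (b δ) / (Gf Gη v (c δ) * Gf Gη (d δ) (b δ)); Gη.Reachable (c δ) (b δ) → |condAvoid - hS * F (min 1 (Real.sqrt Λ))| ≤ ε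

-- earlier DrivingIdentification (stmt-CriticalPhenomena-4513, replaced 2026-08-15T11:40:04Z -> stmt-CriticalPhenomena-5126): retired by None — SlitExcursionCardy → SimpleSubseqLimits → SubseqIdentification
/-- item stmt-CriticalPhenomena-5126 · crux · rank 4 · open · by planner
why it might fail: Typed hypotheses may be too weak for the passage: driving-function convergence along the SAW must come from convergence to SIMPLE limits alone, the RW cross-ratio → conformal cross-ratio is needed uniformly in slit domains (KozdronLawler2005-type, unvendored), and sup|W| needs L³ tails.
sources: LawlerSchrammWerner2004, CDHKSCRAS2014, DuminilCopinSmirnov2012Clay, KemppainenSmirnov2017, KozdronLawler2005, Literature.Probability.RandomPlanarGeometry.isSLELaw_of_isLocalMartingale_driving_of_lt_four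
[crux] r4 DrivingIdentification = SlitExcursionCardy → SimpleSubseqLimits → SubseqIdentification
(the two hypotheses after SlitExcursionCardy are INLINED verbatim — the decls SimpleSubseqLimits
(rank 5) and SubseqIdentification (support, stmt-CriticalPhenomena-0783) are rendered later in the
file; the term is rfl-equal to the named form, checked in the planner sketch). Martingale
identification from the excursion observable, proof plan = the CDHKS/LSW pipeline for THIS
observable: (i) subsequential limit μ carried by simple chords ⇒ Loewner parametrisation through a
chordal uniformizer with continuous driving process W (Lawler Prop. 4.4; tree
LoewnerSlitTheorem/SlitLoewnerChain) and W^δ → W along the SAW; (ii) the exact bounded lattice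
martingale n ↦ P[ω∩γ=∅ | γ[0,n]] = h^δ_n · N_δ(γ[0,n]) plus SlitExcursionCardy plus
KozdronLawler2005 (√Λ → conformal cross-ratio uniformly over slit domains) make t ↦
g_t′(c)g_t′(d)((d−c)/(g_t(d)−g_t(c)))²·F((g_t(c)−W_t)/(g_t(d)−W_t)) a μ-martingale (passage as in
tree ObservableLimitPassage); (iii) far-field expansion at c = py, d = qy, y → ∞ (tree
ObservableDrivingMartingales pattern; needs sup|W| ∈ L³): W_t and W_t² − κ̂t martingales with
κ̂(p/q) -/
@[route_item "route-CriticalPhenomena-SAWExcursionCardy", crux]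
def DrivingIdentification : Prop :=
  SlitExcursionCardy → (∀ (D : Literature.Probability.RandomPlanarGeometry.DobrushinDomain) (a b : ℝ → Literature.Probability.LatticeModels.Site 2), Literature.Probability.RandomPlanarGeometry.SAW.IsEndpointApprox D a b → ∀ (s : ℕ → ℝ) (μ : MeasureTheory.Measure (Literature.Probability.RandomPlanarGeometry.CurveClass ℂ)), Filter.Tendsto s Filter.atTop (nhdsWithin 0 (Set.Ioi 0)) → MeasureTheory.IsProbabilityMeasure μ → (∀ f : BoundedContinuousFunction (Literature.Probability.RandomPlanarGeometry.CurveClass ℂ) ℝ, Filter.Tendsto (fun n => ∫ γ, f γ.curve ∂(Literature.Probability.RandomPlanarGeometry.SAW.law D.carrier (s n) (a (s n)) (b (s n)))) Filter.atTop (nhds (∫ x, f x ∂μ))) → ∀ᵐ γ ∂μ, γ ∈ Literature.Probability.RandomPlanarGeometry.CurveClass.simple ∧ γ.range ∩ frontier D.carrier ⊆ {D.pt 0, D.pt 1}) → (∀ (D : Literature.Probability.RandomPlanarGeometry.DobrushinDomain) (a b : ℝ → Literature.Probability.LatticeModels.Site 2), Literature.Probability.RandomPlanarGeometry.SAW.IsEndpointApprox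 D a b → ∀ (s : ℕ → ℝ) (μ : MeasureTheory.Measure (Literature.Probability.RandomPlanarGeometry.CurveClass ℂ)), Filter.Tendsto s Filter.atTop (nhdsWithin 0 (Set.Ioi 0)) → MeasureTheory.IsProbabilityMeasure μ → (∀ f : BoundedContinuousFunction (Literature.Probability.RandomPlanarGeometry.CurveClass ℂ) ℝ, Filter.Tendsto (fun n => ∫ γ, f γ.curve ∂(Literature.Probability.RandomPlanarGeometry.SAW.law D.carrier (s n) (a (s n)) (b (s n)))) Filter.atTop (nhds (∫ x, f x ∂μ))) → Literature.Probability.RandomPlanarGeometry.IsSLELaw ((8 : NNReal) / 3) D μ)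

/-- item stmt-CriticalPhenomena-4514 · crux · rank 5 · open · by planner
why it might fail: Weak limits of simple polylines need not be simple: needs uniform no-macroscopic-self-touching and no-boundary-crawling bounds for the x_c-SAW under EVERY endpoint approximation (interior a_δ included); only sub-ballisticity is in print, LSW04 p.14 argue simplicity heuristically.
sources: LawlerSchrammWerner2004SAW, KennedyLawler2013, DuminilCopinHammond2013, Summits/CriticalPhenomena/SAWScalingLimit/Ideas/brownian-domination-simple-limits.md, stmt-CriticalPhenomena-0774
[crux] (card r4, regularity half; subsequential form of SAWConfRestriction.SimpleOfLimit
stmt-CriticalPhenomena-0774, which asks it only for a FULL limit) for every Dobrushin domain,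
endpoint approximation, mesh sequence s_n → 0+ and probability measure μ on CurveClass ℂ that is the
weak limit of the SAW laws along s_n: μ-a.e. curve is simple and meets ∂Ω only at a, b. This is what
makes subsequential limits Loewner-parametrisable for DrivingIdentification; it is implied by the
conjunct (SLE_{8/3} is a simple chord) and is the target of idea card
brownian-domination-simple-limits. [difficulty: open-problem] -/
@[route_item "route-CriticalPhenomena-SAWExcursionCardy", crux]
def SimpleSubseqLimits : Prop :=
  ∀ (D : Literature.Probability.RandomPlanarGeometry.DobrushinDomain) (a b : ℝ → Literature.Probability.LatticeModels.Site 2), Literature.Probability.RandomPlanarGeometry.SAW.IsEndpointApprox D a b → ∀ (s : ℕ → ℝ) (μ : MeasureTheory.Measure (Literature.Probability.RandomPlanarGeometry.CurveClass ℂ)), Filter.Tendsto s Filter.atTop (nhdsWithin 0 (Set.Ioi 0)) → MeasureTheory.IsProbabilityMeasure μ → (∀ f : BoundedContinuousFunction (Literature.Probability.RandomPlanarGeometry.CurveClass ℂ) ℝ, Filter.Tendsto (fun n => ∫ γ, f γ.curve ∂(Literature.Probability.RandomPlanarGeometry.SAW.law D.carrier (s n) (a (s n)) (b (s n)))) Filter.atTop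 (nhds (∫ x, f x ∂μ))) → ∀ᵐ γ ∂μ, γ ∈ Literature.Probability.RandomPlanarGeometry.CurveClass.simple ∧ γ.range ∩ frontier D.carrier ⊆ {D.pt 0, D.pt 1}

/-- item stmt-CriticalPhenomena-1881 · crux · rank 6 · SPLIT (gen 1) into ConfinementPositivity, VirginArcTraversalTight + glue EventualTightOfSubs · direct attempts still welcome (low priority) · by planner
why it might fail: Open for SAW: no RSW / annulus-crossing bound at x_c (KemppainenSmirnov2017 §4 covers FKG models only; route SAWLeftRightFKG bets on a left–right FKG); the all-δ form stmt-CriticalPhenomena-0772 is refuted and only sub-ballisticity is unconditional.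
sources: KemppainenSmirnov2017, AizenmanBurchardDuke1999, DuminilCopinHammond2013, Summit.CriticalPhenomena.SAWScalingLimit.Theorems.SAWParafermionTight_refuted, stmt-CriticalPhenomena-1881
[support] EVENTUAL TIGHTNESS of the critical SAW laws: for every Dobrushin domain and endpoint
approximation, IsTightAlongMesh (fun δ γ => γ.curve) (fun δ => SAW.law D δ a_δ b_δ) — for every ε
some compact set of CurveClass ℂ carries all but ε of the mass for all small δ. This is the form the
Prokhorov criterion convergesInLawToSLE_of_isTightAlongMesh consumes and the repair of the refuted
all-δ Tight (IsTightLaws over δ ∈ (0,1]) suggested by the refuting theorem; offered to routes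
SAWParafermion / SAWConfRestriction as their restated r3/r4. -/
@[route_item "route-CriticalPhenomena-SAWExcursionCardy", crux]
def EventualTight : Prop :=
  ∀ (D : Literature.Probability.RandomPlanarGeometry.DobrushinDomain) (a b : ℝ → Literature.Probability.LatticeModels.Site 2), Literature.Probability.RandomPlanarGeometry.SAW.IsEndpointApprox D a b → Literature.Probability.RandomPlanarGeometry.IsTightAlongMesh (fun δ (γ : Literature.Probability.RandomPlanarGeometry.SAW.DomainSAW D.carrier δ (a δ) (b δ)) => γ.curve) (fun δ => Literature.Probability.RandomPlanarGeometry.SAW.law D.carrier δ (a δ) (b δ))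

-- parent: EventualTight · child (gen 1)
/--     item stmt-CriticalPhenomena-17587 · crux · rank 601 · open
    parent: EventualTight · by operator
    why it might fail: RSW-type LOWER bound for the x_c-SAW proved on no lattice (no FKG/duality/ℤ² observable); absolute bounds give only e^{-C/δ} ≤ Z_{D'}/Z_D; PA substitute blocked on CriticalBubbleBound stmt-7117; thin-tube pairs need limsup W·m_W(x_c) < ∞ (RSW for Kesten's irreducible bridges).
    sources: LawlerSchrammWerner2004SAW, KemppainenSmirnov2017, DuminilCopinHammond2013, MadrasSlade1993, arXiv:1707.09335, stmt-CriticalPhenomena-17587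
[crux] restriction positivity (the SAW box-crossing property): for nested Dobrushin domains D' ⊆ D
with the same marked points and sockets D ∩ (B(a,d) ∪ B(b,d)) ⊆ D', and every endpoint approximation
of D', the critical SAW of D_δ from a_δ to b_δ is a D'_δ-walk with probability ≥ c > 0 for all δ ∈
(0, δ₀]. Equivalent to liminf_δ Z_{D'}(a_δ,b_δ)/Z_D(a_δ,b_δ) > 0
(Theorems.confinementPositivity_iff_partitionRatio, p103341); implied by SAWScalingLimit
(Theorems.confinementPositivity_of_scalingLimit, p105757), so summit-safe; monotone in nested
quadruples (Theorems.confinementRatio_mono, p139226), hence reducible to standard pairs (tube inside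
an enlargement). Verbatim the registered stub stub_confinementPositivity of lines Sketch v5
(stmt-1372) and confinement-bulk-tightness (stmt-4728). Numerics: Z_{D'}/Z_D ≈ 0.6–0.7 flat in δ
(PERM j012789, Cruxes/ShellCrossingBound/ToyDataIdeator2.md). -/
@[route_item "route-CriticalPhenomena-SAWExcursionCardy", crux]
def ConfinementPositivity : Prop :=
  ∀ (D D' : Literature.Probability.RandomPlanarGeometry.DobrushinDomain) (a b : ℝ → Literature.Probability.LatticeModels.Site 2) (d : ℝ), 0 < d → D'.carrier ⊆ D.carrier → D'.pt 0 = D.pt 0 → D'.pt 1 = D.pt 1 → D.carrier ∩ (Metric.ball (D.pt 0) d ∪ Metric.ball (D.pt 1) d) ⊆ D'.carrier → Literature.Probability.RandomPlanarGeometry.SAW.IsEndpointApprox D' a b → ∃ c δ₀ : ℝ, 0 < c ∧ 0 < δ₀ ∧ ∀ δ ∈ Set.Ioc (0 : ℝ) δ₀, ENNReal.ofReal c ≤ Literature.Probability.RandomPlanarGeometry.SAW.law D.carrier δ (a δ) (b δ) {γ | ∃ γ' : Literature.Probability.RandomPlanarGeometry.SAW.DomainSAW D'.carrier δ (a δ)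 (b δ), γ'.walk.support = γ.walk.support}

-- parent: EventualTight · child (gen 1)
/--     item stmt-CriticalPhenomena-17940 · crux · rank 602 · open
    parent: EventualTight · by operator
    why it might fail: No one-scale non-degeneracy tool for the critical ℤ² SAW arc (no FKG/BK/RSW/observable; sup-over-past forms false by corridors; fixed-resolution surgery dead); uniform over EXTERIORS, so a forcing exterior through the two doors could refute it while BulkShellTight survives (then resplit).
    sources: KemppainenSmirnov2017, AizenmanBurchardDuke1999, MadrasSlade1993, DuminilCopinHammond2013, arXiv:2310.17299, Summits/CriticalPhenomena/SAWScalingLimit/Cruxes/EventualTight/LeadAnalysis-c4.md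
[crux] THE BULK ATOM X2c₁ — Kemppainen–Smirnov Condition G2/G3 for the critical ℤ² SAW ARC measure
of a VIRGIN lattice disc at ONE interior annulus shape, uniform over everything outside the disc
(pure lattice, mesh-free, rate-free, numerically testable at fixed N): for every θ > 0 there are k,
N₀ such that for every configuration (H, Λ) virgin in the closed lattice disc B̄(z₀, N) ∩ ℤ², N ≥ N₀
(H ≤ ℤ², every lattice point of the disc allowed, every lattice edge of B̄(z₀, N+1) an H-edge,
NOTHING assumed outside) and every two doors (u,c), (u′,c′) on the rim, the x_c-mass of
self-avoiding H-arcs c → c′ in Λ whose vertex sequence makes k weak traversals of D(z₀; 2N/5, 3N/5)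
is ≤ θ · (mass of all arcs). VERBATIM the registered stub stub_virginArcTraversalTight of
stmt-1372's live skeleton Sketch v7 (lead c4) — one proof closes both. With child 1 it gives the
parent by LANDED theorems only: bulkShellTightAtAspectTwo_of_virginArcTraversalTight (two-sided
domain-Markov virginization V1a/V1b/V2/V3/V4, p141866/p141673/p141996/p141593 + …Virginization.lean)
and stub_aspectReduction (…AspectReduction.lean) give BulkShellTight (stmt-17588);
Theorems.EventualTight_of_subs (p142166) gives the se -/
@[route_item "route-CriticalPhenomena-SAWExcursionCardy", crux]
def VirginArcTraversalTight : Prop :=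
  ∀ θ : ℝ, 0 < θ → ∃ (k : ℕ) (N₀ : ℝ), 0 < N₀ ∧ ∀ (H : SimpleGraph (Literature.Probability.LatticeModels.Site 2)) (Λ : Set (Literature.Probability.LatticeModels.Site 2)) (z₀ : ℂ) (N : ℝ) (u c u' c' : Literature.Probability.LatticeModels.Site 2), N₀ ≤ N → (H ≤ Literature.Probability.LatticeModels.zdGraph 2 ∧ (∀ v : Literature.Probability.LatticeModels.Site 2, dist (Literature.Probability.LatticeModels.Site.toComplex v) z₀ ≤ N → v ∈ Λ) ∧ ∀ v v' : Literature.Probability.LatticeModels.Site 2, dist (Literature.Probability.LatticeModels.Site.toComplex v) z₀ ≤ N + 1 → dist (Literature.Probability.LatticeModels.Site.toComplex v') z₀ ≤ N + 1 → (Literature.Probability.LatticeModels.zdGraph 2).Adj v v' → H.Adj v v') → (H.Adj u c ∧ u ∉ Λ ∧ c ∈ Λ ∧ dist (Literature.Probability.LatticeModels.Site.toComplex c) z₀ ≤ N ∧ N < dist (Literature.Probability.LatticeModels.Site.toComplex u) z₀) → (H.Adj u' c' ∧ u' ∉ Λ ∧ c' ∈ Λ ∧ dist (Literature.Probability.LatticeModels.Site.toComplex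 c') z₀ ≤ N ∧ N < dist (Literature.Probability.LatticeModels.Site.toComplex u') z₀) → ∑' p : {p : {p : H.Walk c c' // p.IsPath ∧ ∀ v ∈ p.support, v ∈ Λ} // ∃ ι κ : Fin k → Fin (p.1.support.map Literature.Probability.LatticeModels.Site.toComplex).length, (∀ m, ι m ≤ κ m) ∧ (∀ m, (dist ((p.1.support.map Literature.Probability.LatticeModels.Site.toComplex).get (ι m)) z₀ ≤ 2 * N / 5 ∧ 3 * N / 5 ≤ dist ((p.1.support.map Literature.Probability.LatticeModels.Site.toComplex).get (κ m)) z₀) ∨ (3 * N / 5 ≤ dist ((p.1.support.map Literature.Probability.LatticeModels.Site.toComplex).get (ι m)) z₀ ∧ dist ((p.1.support.map Literature.Probability.LatticeModels.Site.toComplex).get (κ m)) z₀ ≤ 2 * N / 5)) ∧ ∀ ⦃m m'⦄, m < m' → κ m ≤ ι m'}, ENNReal.ofReal (Literature.Probability.RandomPlanarGeometry.SAW.criticalFugacity ^ p.1.1.length) ≤ ENNReal.ofReal θ * ∑' p : {p : H.Walk c c' // p.IsPath ∧ ∀ v ∈ p.support, v ∈ Λ}, ENNReal.ofReal (Literature.Probability.RandomPlanarGeometry.SAW.criticalFugacity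 ^ p.1.length)

-- parent: EventualTight · glue (gen 1)
/--     item stmt-CriticalPhenomena-17941 · support · rank 603 · open
    parent: EventualTight · GLUE: children ⟹ parent · by operator
EventualTight_of_subs : ConfinementPositivity → VirginArcTraversalTight → EventualTight —
restriction positivity (stmt-17587, shared with the twin split of stmt-1372) and the
exterior-uniform virgin-arc traversal atom X2c₁ of the critical ℤ² SAW give the along-mesh crux by
LANDED theorems only: bulkShellTightAtAspectTwo_of_virginArcTraversalTight (virginization V4) +
stub_aspectReduction ⇒ BulkShellTight; Theorems.EventualTight_of_subs (p142166) ⇒ set-form twin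
stmt-1372; isTightAlongMesh_of_isTightMeasureSet_image ⇒ along the mesh. Kernel-checked glue
attached as evidence on stmt-1881 (SAWExcursionCardyEventualTightSplit.lean: theorem
EventualTight_of_subs = the registered stub of stmt-1881 verbatim; lean check rc 0, 0 sorry, axioms
propext/Classical.choice/Quot.sound) together with the 8-line closing file of this glue item
(eventualTightOfSubs_proof, Sketch.lean) for any prover to land. -/
@[route_item "route-CriticalPhenomena-SAWExcursionCardy"]
def EventualTightOfSubs : Prop :=
  ConfinementPositivity → VirginArcTraversalTight → EventualTight

/-- item stmt-CriticalPhenomena-15712 · crux · rank 7 · open · by planner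
why it might fail: Unprinted for THIS discretisation (largest mesh component, closed-segment edges, EDGE-killed walk; any Jordan Ω; p_δ→u at any rate): needs a lattice-scale uniform BHP at u for edge-diluted graphs — ChelkakWan2021 Cor 3.8 is induced-only; edge defects at all scales near a wild ∂Ω could spoil it.
sources: KozdronLawler2005, ChelkakWan2021, LawlerSchrammWerner2004, ChelkakSmirnov2011, Chelkak2016, arXiv:math/0506337
[crux] (r7 — route-choice repair 2026-08-16: PROMOTED from the mis-filed named fact
Literature.Probability.LatticeModels.KozdronLawler2005_martinRatioBoundaryLimit, ruled ×4 by
literature-provers UNPRINTED for the tree's discretisation, i.e. summit-side content, XL; statement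
= that def's body VERBATIM, Iff.rfl) MARTIN-KERNEL RATIO BOUNDARY LIMIT FOR THE EDGE-KILLED Ω_δ-WALK
OF A JORDAN DOMAIN: for every Jordan domain Ω, conformal ψ : ℍ → Ω with boundary values u = ψ(s), v
= ψ(t), w = ψ(r) at three distinct reals (u, v, w distinct points of ∂Ω), every evaluation family
p_δ ∈ Ω_δ = meshDomain Ω δ with δp_δ → u (any rate: boundary vertices or interior vertices at
vanishing distance), boundary-vertex POLE families q_δ, e_δ ∈ meshBoundary Ω δ with δq_δ → v, δe_δ →
w, and base point o_δ ∈ Ω_δ with δo_δ → ψ(i): [G(p,q)/G(o,q)] / [G(p,e)/G(o,e)] →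
(s−r)²(1+t²)/((s−t)²(1+r²)) as δ → 0⁺, where G = SRW.killedGreen (discreteDomainGraph Ω δ) is the
Green function of SRW run along Ω_δ-edges and killed at its first non-edge step — the boundary limit
at s of the ratio of the two half-plane Martin kernels Im z(1+t²)/|z−t|², Im z(1+r²)/|z−r|²
normalised at i (continuum shadow proved: Literature ten -/
@[route_item "route-CriticalPhenomena-SAWExcursionCardy"]
def MartinRatioBoundaryLimit : Prop :=
  ∀ (D : Literature.Probability.RandomPlanarGeometry.JordanDomain) (ψ : Literature.Probability.RandomPlanarGeometry.ConformalEquiv UpperHalfPlane.upperHalfPlaneSet D.carrier) (s t r : ℝ) (u v w : ℂ), s ≠ t → s ≠ r → t ≠ r → u ≠ v → u ≠ w → v ≠ w → u ∈ frontier D.carrier → v ∈ frontier D.carrier → w ∈ frontier D.carrier → ψ.HasBoundaryValue s u → ψ.HasBoundaryValue t v → ψ.HasBoundaryValue r w → ∀ (p q e o : ℝ → Literature.Probability.LatticeModels.Site 2), Filter.Tendsto (fun δ => Literature.Probability.LatticeModels.meshPoint δ (p δ)) (nhdsWithin 0 (Set.Ioi 0)) (nhds u) → Filter.Tendsto (fun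 δ => Literature.Probability.LatticeModels.meshPoint δ (q δ)) (nhdsWithin 0 (Set.Ioi 0)) (nhds v) → Filter.Tendsto (fun δ => Literature.Probability.LatticeModels.meshPoint δ (e δ)) (nhdsWithin 0 (Set.Ioi 0)) (nhds w) → Filter.Tendsto (fun δ => Literature.Probability.LatticeModels.meshPoint δ (o δ)) (nhdsWithin 0 (Set.Ioi 0)) (nhds (ψ Complex.I)) → (∀ᶠ δ in nhdsWithin 0 (Set.Ioi 0), p δ ∈ Literature.Probability.LatticeModels.meshDomain D.carrier δ ∧ q δ ∈ Literature.Probability.LatticeModels.meshBoundary D.carrier δ ∧ e δ ∈ Literature.Probability.LatticeModels.meshBoundary D.carrier δ ∧ o δ ∈ Literature.Probability.LatticeModels.meshDomain D.carrier δ) → let Gf : SimpleGraph (Literature.Probability.LatticeModels.Site 2) → Literature.Probability.LatticeModels.Site 2 → Literature.Probability.LatticeModels.Site 2 → ℝ := fun Gr x y => ∑' n : ℕ, (Literature.Probability.LatticeModels.SRW.pathLaw 2).real {ω | (∀ j < n, Gr.Adj (x + Literature.Probability.LatticeModels.SRW.S ω j) (x + Literature.Probability.LatticeModels.SRW.S ω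 (j + 1))) ∧ x + Literature.Probability.LatticeModels.SRW.S ω n = y}; Filter.Tendsto (fun δ => Gf (Literature.Probability.LatticeModels.discreteDomainGraph D.carrier δ) (p δ) (q δ) / Gf (Literature.Probability.LatticeModels.discreteDomainGraph D.carrier δ) (o δ) (q δ) / (Gf (Literature.Probability.LatticeModels.discreteDomainGraph D.carrier δ) (p δ) (e δ) / Gf (Literature.Probability.LatticeModels.discreteDomainGraph D.carrier δ) (o δ) (e δ))) (nhdsWithin 0 (Set.Ioi 0)) (nhds ((s - r) ^ 2 * (1 + t ^ 2) / ((s - t) ^ 2 * (1 + r ^ 2))))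

/-- item stmt-CriticalPhenomena-0783 · support · rank 9 · open · by planner
sources: LawlerSchrammWerner2004SAW, LawlerSchrammWerner2003Restriction, stmt-CriticalPhenomena-0783
[crux] r3: identification of subsequential limits — for every Dobrushin domain D, endpoint
approximation (a_δ,b_δ), sequence s_n → 0+ and probability measure μ on CurveClass ℂ, if ∫ f∘curve
d(Literature.Probability.RandomPlanarGeometry.SAW.law D (s n) …) → ∫ f dμ for all bounded continuous
f then μ is the chordal SLE_{8/3} law in D (Literature.Probability.RandomPlanarGeometry.IsSLELaw
(8/3) D μ). Obtained from r2 (observable limit) by the martingale principle (LSW03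
arXiv:math/0209343 Prop. 5.2: κ = 8/3 is singled out by the 5/8-observable), or from restriction
(sibling route). -/
@[route_item "route-CriticalPhenomena-SAWExcursionCardy"]
def SubseqIdentification : Prop :=
  ∀ (D : Literature.Probability.RandomPlanarGeometry.DobrushinDomain) (a b : ℝ → Literature.Probability.LatticeModels.Site 2), Literature.Probability.RandomPlanarGeometry.SAW.IsEndpointApprox D a b → ∀ (s : ℕ → ℝ) (μ : MeasureTheory.Measure (Literature.Probability.RandomPlanarGeometry.CurveClass ℂ)), Filter.Tendsto s Filter.atTop (nhdsWithin 0 (Set.Ioi 0)) → MeasureTheory.IsProbabilityMeasure μ → (∀ f : BoundedContinuousFunction (Literature.Probability.RandomPlanarGeometry.CurveClass ℂ) ℝ, Filter.Tendsto (fun n => ∫ γ, f γ.curve ∂(Literature.Probability.RandomPlanarGeometry.SAW.law D.carrier (s n) (a (s n)) (b (s n)))) Filter.atTop (nhds (∫ x, f x ∂μ))) → Literature.Probability.RandomPlanarGeometry.IsSLELaw ((8 : NNReal) / 3) D μ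

/-- item stmt-CriticalPhenomena-15791 · support · rank 9 · open · by planner
[support] glue, provable now in ONE line: MartinRatioBoundaryLimit → RWGreenCrossRatioLimit, by `fun
h =>
Summit.CriticalPhenomena.SAWScalingLimit.Theorems.RWGreenCrossRatioLimit_of_martinRatioBoundaryLimit
h` (Theorems/SAWExcursionCardyRWGreenCrossRatioLimitMartin.lean, p109376 — the crux is Iff.rfl-equal
to that theorem's hypothesis
Literature.Probability.LatticeModels.KozdronLawler2005_martinRatioBoundaryLimit). Records in the
route file that the support item RWGreenCrossRatioLimit (stmt-CriticalPhenomena-4515) is closed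
modulo the crux MartinRatioBoundaryLimit (route-choice repair 2026-08-16). [deps:
MartinRatioBoundaryLimit, RWGreenCrossRatioLimit] [difficulty: provable-now] SOURCES:
Summit.CriticalPhenomena.SAWScalingLimit.Theorems.RWGreenCrossRatioLimit_of_martinRatioBoundaryLimit,
KozdronLawler2005 -/
@[route_item "route-CriticalPhenomena-SAWExcursionCardy"]
def RWGreenCrossRatioLimitOfMartin : Prop :=
  MartinRatioBoundaryLimit → (∀ (R : Literature.Probability.RandomPlanarGeometry.ConformalRectangle) (a b c d : ℝ → Literature.Probability.LatticeModels.Site 2), Literature.Probability.RandomPlanarGeometry.SAW.IsEndpointApprox (R.chord 0 3 (by decide)) a b → Filter.Tendsto (fun δ => Literature.Probability.LatticeModels.meshPoint δ (c δ)) (nhdsWithin 0 (Set.Ioi 0)) (nhds (R.pt 1)) → Filter.Tendsto (fun δ => Literature.Probability.LatticeModels.meshPoint δ (d δ)) (nhdsWithin 0 (Set.Ioi 0)) (nhds (R.pt 2)) → (∀ᶠ δ in nhdsWithin 0 (Set.Ioi 0), c δ ∈ Literature.Probability.LatticeModels.meshBoundary R.carrier δ ∧ d δ ∈ Literature.Probability.LatticeModels.meshBoundary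 R.carrier δ) → let Gf : SimpleGraph (Literature.Probability.LatticeModels.Site 2) → Literature.Probability.LatticeModels.Site 2 → Literature.Probability.LatticeModels.Site 2 → ℝ := fun Gr p q => ∑' n : ℕ, (Literature.Probability.LatticeModels.SRW.pathLaw 2).real {ω | (∀ j < n, Gr.Adj (p + Literature.Probability.LatticeModels.SRW.S ω j) (p + Literature.Probability.LatticeModels.SRW.S ω (j + 1))) ∧ p + Literature.Probability.LatticeModels.SRW.S ω n = q}; ∀ (φ : Literature.Probability.RandomPlanarGeometry.ConformalEquiv UpperHalfPlane.upperHalfPlaneSet R.carrier) (x : Fin 4 → ℝ), R.IsUniformizing φ x → Filter.Tendsto (fun δ => Real.sqrt (Gf (Literature.Probability.LatticeModels.discreteDomainGraph R.carrier δ) (a δ) (d δ) * Gf (Literature.Probability.LatticeModels.discreteDomainGraph R.carrier δ) (c δ) (b δ) / (Gf (Literature.Probability.LatticeModels.discreteDomainGraph R.carrier δ) (a δ) (c δ) * Gf (Literature.Probability.LatticeModels.discreteDomainGraph R.carrier δ) (d δ) (b δ)))) (nhdsWithin 0 (Set.Ioi 0)) (nhds (Literature.Probability.RandomPlanarGeometry.crossRatio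 x)))

/-- item stmt-CriticalPhenomena-4515 · support · rank 9 · open · by planner
sources: KozdronLawler2005, Lawler2005, LawlerSchrammWerner2004
[support] (random-walk side, provable from print) for R, approximations as in ExcursionCardyFormula
(a_δ, b_δ any endpoint approximation, c_δ, d_δ boundary vertices) and every uniformizing datum (φ,
x): the random-walk cross-ratio √Λ_δ, Λ_δ = G(a_δ,d_δ)G(c_δ,b_δ)/(G(a_δ,c_δ)G(d_δ,b_δ)) with G the
Green function of SRW on Ω_δ killed at its first non-Ω_δ step, tends to crossRatio x. Mechanism:
KozdronLawler2005 Thm 1.1/1.2 (uniformly over simply connected lattice domains, excursion kernel and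
Green function factor as local(x)·local(y)·conformal part; in the 4-ratio every point occurs once up
and once down, so local parts cancel) + boundary Harnack for the possibly interior a_δ, b_δ. The η =
nil instance of what DrivingIdentification needs in slit domains; with SlitExcursionCardy (η = nil)
it re-derives ExcursionCardyFormula. [difficulty: L] -/
@[route_item "route-CriticalPhenomena-SAWExcursionCardy"]
def RWGreenCrossRatioLimit : Prop :=
  ∀ (R : Literature.Probability.RandomPlanarGeometry.ConformalRectangle) (a b c d : ℝ → Literature.Probability.LatticeModels.Site 2), Literature.Probability.RandomPlanarGeometry.SAW.IsEndpointApprox (R.chord 0 3 (by decide)) a b → Filter.Tendsto (fun δ => Literature.Probability.LatticeModels.meshPoint δ (c δ)) (nhdsWithin 0 (Set.Ioi 0)) (nhds (R.pt 1)) → Filter.Tendsto (fun δ => Literature.Probability.LatticeModels.meshPoint δ (d δ)) (nhdsWithin 0 (Set.Ioi 0)) (nhds (R.pt 2)) → (∀ᶠ δ in nhdsWithin 0 (Set.Ioi 0), c δ ∈ Literature.Probability.LatticeModels.meshBoundary R.carrier δ ∧ d δ ∈ Literature.Probability.LatticeModels.meshBoundary R.carrier δ) → let Gf : SimpleGraph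 (Literature.Probability.LatticeModels.Site 2) → Literature.Probability.LatticeModels.Site 2 → Literature.Probability.LatticeModels.Site 2 → ℝ := fun Gr p q => ∑' n : ℕ, (Literature.Probability.LatticeModels.SRW.pathLaw 2).real {ω | (∀ j < n, Gr.Adj (p + Literature.Probability.LatticeModels.SRW.S ω j) (p + Literature.Probability.LatticeModels.SRW.S ω (j + 1))) ∧ p + Literature.Probability.LatticeModels.SRW.S ω n = q}; ∀ (φ : Literature.Probability.RandomPlanarGeometry.ConformalEquiv UpperHalfPlane.upperHalfPlaneSet R.carrier) (x : Fin 4 → ℝ), R.IsUniformizing φ x → Filter.Tendsto (fun δ => Real.sqrt (Gf (Literature.Probability.LatticeModels.discreteDomainGraph R.carrier δ) (a δ) (d δ) * Gf (Literature.Probability.LatticeModels.discreteDomainGraph R.carrier δ) (c δ) (b δ) / (Gf (Literature.Probability.LatticeModels.discreteDomainGraph R.carrier δ) (a δ) (c δ) * Gf (Literature.Probability.LatticeModels.discreteDomainGraph R.carrier δ) (d δ) (b δ)))) (nhdsWithin 0 (Set.Ioi 0)) (nhds (Literature.Probability.RandomPlanarGeometry.crossRatio x))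

/-- item stmt-CriticalPhenomena-4516 · support · rank 9 · closed · proved by Summit.CriticalPhenomena.SAWScalingLimit.Theorems.CardyFSpec.cardyFSpec_proof @ 73e5626f030a (prover) · by planner
sources: Kozdron2007Fomin, LawlerSchrammWerner2003Restriction, LawlerSchrammWerner2001
[support] (calculus, provable now) the target function F(u) = (8/5)u₂F₁(−1/2,2;7/2;u) solves
2u²(1−u)F″ + u(3−u)F′ − 3(1−u)F = 0 on (0,1) (the κ = 8/3 case of (κ/2)(1−u)²F″ + [2/u − 2u −
κ(1−u)]F′ − 2(1−u)²F/u² = 0, the drift condition of the martingale of DrivingIdentification; κ = 2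
gives Kozdron's u(2−u)), F(1) = 1 (Gauss summation: Γ(7/2)Γ(2)/(Γ(4)Γ(3/2)) = 5/8), F(u)/u → 8/5 at
0 (regular Frobenius exponent 1 = h_{2,4} − h_{1,2} − h_{2,3} = 21/8 − 5/8 − 1; the other exponent
is −3/2), F strictly increasing on [0,1], and the Euler integral F(u) = 6u∫₀¹ t√((1−t)(1−ut)) dt.
Fixes the normalisation every other item uses. [difficulty: provable-now] -/
@[route_item "route-CriticalPhenomena-SAWExcursionCardy"]
def CardyFSpec : Prop :=
  let F : ℝ → ℝ := fun u => (8 / 5 : ℝ) * u * ₂F₁ (-1 / 2 : ℝ) (2 : ℝ) (7 / 2 : ℝ) u; (∀ u ∈ Set.Ioo (0 : ℝ) 1, 2 * u ^ 2 * (1 - u) * deriv (deriv F) u + u * (3 - u) * deriv F u - 3 * (1 - u) * F u = 0) ∧ F 1 = 1 ∧ Filter.Tendsto (fun u => F u / u) (nhdsWithin 0 (Set.Ioi 0)) (nhds (8 / 5 : ℝ)) ∧ StrictMonoOn F (Set.Icc 0 1) ∧ ∀ u ∈ Set.Icc (0 : ℝ) 1, F u = 6 * u * ∫ t in (0 : ℝ)..1,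 t * Real.sqrt ((1 - t) * (1 - u * t))

-- `CardyFSpec` holds: proved by `Summit.CriticalPhenomena.SAWScalingLimit.Theorems.CardyFSpec.cardyFSpec_proof` @ 73e5626f030a (its module imports this route file, so no `_holds` link can be stated here).

-- earlier Assembly (stmt-CriticalPhenomena-4517, replaced 2026-08-15T11:41:35Z -> stmt-CriticalPhenomena-5565): retired by None — ExcursionCardyFormula → SlitExcursionCardy → DrivingIdentification → SimpleSubseqLimits → EventualTight → SAWScalingLimit
/-- item stmt-CriticalPhenomena-5565 · assembly · rank 1 · closed · proved by Summit.CriticalPhenomena.SAWScalingLimit.Theorems.sawExcursionCardy_assembly_proof (prover) · by planner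
sources: Literature.Probability.RandomPlanarGeometry.convergesInLawToSLE_of_isTightAlongMesh, Literature.Probability.RandomPlanarGeometry.IsSLECurve.map_eq_holds, Literature.Probability.RandomPlanarGeometry.SAW.aemeasurable_curve
[assembly] ExcursionCardyFormula → SlitExcursionCardy → SimpleSubseqLimits → DrivingIdentification →
EventualTight → SAWScalingLimit. Proof: DrivingIdentification applied to SlitExcursionCardy and
SimpleSubseqLimits yields SubseqIdentification (the inlined hypotheses of DrivingIdentification are
rfl-equal to the decls); for each (D, a, b) with IsEndpointApprox the SAW laws are probability
measures for all small δ (IsEndpointApprox.reachable ⇒ weight univ ≠ 0; finitely many SAWs in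
bounded Ω_δ ⇒ < ∞), so replace SAW.law by a family of probability measures agreeing with it
eventually (ConvergesInLawToSLE, IsTightAlongMesh and the subsequential-limit hypothesis only see
the germ at 0+), apply the PROVED
Literature.Probability.RandomPlanarGeometry.convergesInLawToSLE_of_isTightAlongMesh with huniq :=
IsSLECurve.map_eq_holds, hY := eventually SAW.aemeasurable_curve, hT := EventualTight, hL :=
SubseqIdentification read through IsSubseqLimitLaw, and unfold SAWScalingLimit.
ExcursionCardyFormula is carried as the (logically redundant, η = nil) headline hypothesis. -/
@[route_item "route-CriticalPhenomena-SAWExcursionCardy"]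
def Assembly : Prop :=
  ExcursionCardyFormula → SlitExcursionCardy → SimpleSubseqLimits → DrivingIdentification → EventualTight → SAWScalingLimit

-- `Assembly` holds: proved by `Summit.CriticalPhenomena.SAWScalingLimit.Theorems.sawExcursionCardy_assembly_proof` (its module imports this route file, so no `_holds` link can be stated here).

/-! D-0027 §2.1 — DECIDING THEOREM (planner-authored via `route open/edit --closes-file`; by planner-rbadge-CriticalPhenomena-SAWExcursionC-24e24fd2-g4-0 2026-08-15T16:57:03Z):
its hypotheses are this route's items and its conclusion the sub-problem Statement (glue_lint), and it elaborates with this file. -/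

@[closes "route-CriticalPhenomena-SAWExcursionCardy"] theorem closes (h_ExcursionCardyFormula : ExcursionCardyFormula)
    (h_SlitExcursionCardy : SlitExcursionCardy) (h_SimpleSubseqLimits : SimpleSubseqLimits)
    (h_DrivingIdentification : DrivingIdentification) (h_EventualTight : EventualTight) :
    _root_.SAWScalingLimit := by
  classical
  -- the headline crux (η = nil case of SlitExcursionCardy) is carried, not consumed
  have _headline : ExcursionCardyFormula := h_ExcursionCardyFormula
  -- the identification node of the route: (N) + (S) processed by (I′)
  have hI : SubseqIdentification :=
    h_DrivingIdentification h_SlitExcursionCardy h_SimpleSubseqLimits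
  intro D a b hab
  -- (1) for `δ > 0` there are finitely many SAWs of `Ω_δ` between two sites: their supports are
  -- duplicate-free lists over the finite set `insert u (meshDomain Ω δ)`
  have hfinite : ∀ {δ : ℝ}, 0 < δ → ∀ u v : Literature.Probability.LatticeModels.Site 2,
      Finite (Literature.Probability.RandomPlanarGeometry.SAW.DomainSAW D.carrier δ u v) := by
    intro δ hδ u v
    let S : Set (Literature.Probability.LatticeModels.Site 2) :=
      insert u (Literature.Probability.LatticeModels.meshDomain D.carrier δ)
    have hfin : S.Finite :=
      (Literature.Probability.LatticeModels.meshDomain_finite D.isBounded hδ).insert u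
    haveI : Fintype ↥S := hfin.fintype
    have hsupp : ∀ γ : Literature.Probability.RandomPlanarGeometry.SAW.DomainSAW D.carrier δ u v,
        ∀ w ∈ γ.walk.support, w ∈ S := by
      intro γ
      have key : ∀ {x y : Literature.Probability.LatticeModels.Site 2}
          (p : (Literature.Probability.LatticeModels.discreteDomainGraph D.carrier δ).Walk x y),
          x ∈ S → ∀ w ∈ p.support, w ∈ S := by
        intro x y p
        induction p with
        | nil =>
          intro hx w hw
          rw [SimpleGraph.Walk.support_nil, List.mem_singleton] at hw
          exact hw ▸ hx
        | cons h p ih =>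
          intro hx w hw
          rw [SimpleGraph.Walk.support_cons, List.mem_cons] at hw
          rcases hw with rfl | hw
          · exact hx
          · exact ih (Set.mem_insert_of_mem _
              (Literature.Probability.LatticeModels.discreteDomainGraph_adj_iff.1 h).2.2) w hw
      exact key γ.walk (Set.mem_insert _ _)
    let f : Literature.Probability.RandomPlanarGeometry.SAW.DomainSAW D.carrier δ u v →
        {l : List ↥S // l.length ≤ Fintype.card ↥S} :=
      fun γ => ⟨γ.walk.support.pmap (fun w hw => ⟨w, hw⟩) (hsupp γ), by
        rw [List.length_pmap]
        have hnd : (γ.walk.support.pmap (fun w hw => (⟨w, hw⟩ : ↥S)) (hsupp γ)).Nodup := by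
          refine List.Nodup.pmap ?_ γ.isPath.support_nodup
          intro a _ b _ h
          exact congrArg Subtype.val h
        have := hnd.length_le_card
        rwa [List.length_pmap] at this⟩
    haveI : Finite {l : List ↥S // l.length ≤ Fintype.card ↥S} :=
      (List.finite_length_le _ _).to_subtype
    refine Finite.of_injective f fun γ γ' h => ?_
    have h' := congrArg
      (fun l : {l : List ↥S // l.length ≤ Fintype.card ↥S} => l.1.map Subtype.val) h
    have hs : γ.walk.support = γ'.walk.support := by
      simpa [f, List.map_pmap] using h'
    rcases γ with ⟨p, hp⟩
    rcases γ' with ⟨q, hq⟩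
    simp only at hs
    have := SimpleGraph.Walk.support_injective hs
    subst this
    rfl
  -- (2) the critical SAW laws are probability measures for all small `δ > 0`
  -- (`0 < Z_δ < ∞`: `a_δ, b_δ` joined in `Ω_δ`, `x_c > 0`, finitely many SAWs)
  have hgood : ∀ᶠ δ in 𝓝[>] (0 : ℝ), IsProbabilityMeasure
      (Literature.Probability.RandomPlanarGeometry.SAW.law D.carrier δ (a δ) (b δ)) := by
    filter_upwards [hab.reachable, self_mem_nhdsWithin] with δ hr hδ
    haveI := hfinite hδ (a δ) (b δ)
    haveI : Fintype (Literature.Probability.RandomPlanarGeometry.SAW.DomainSAW D.carrier δ (a δ) (b δ)) :=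
      Fintype.ofFinite _
    have htop : Literature.Probability.RandomPlanarGeometry.SAW.weight D.carrier δ (a δ) (b δ)
        Set.univ ≠ ⊤ := by
      rw [Literature.Probability.RandomPlanarGeometry.SAW.weight,
        Measure.sum_apply _ MeasurableSpace.measurableSet_top, tsum_fintype]
      refine ENNReal.sum_ne_top.2 fun γ _ => ?_
      simp
    obtain ⟨p⟩ := hr
    let γ₀ : Literature.Probability.RandomPlanarGeometry.SAW.DomainSAW D.carrier δ (a δ) (b δ) :=
      ⟨p.toPath, p.toPath.2⟩
    have hpos : Literature.Probability.RandomPlanarGeometry.SAW.weight D.carrier δ (a δ) (b δ)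
        Set.univ ≠ 0 := by
      intro h0
      have h1 : Literature.Probability.RandomPlanarGeometry.SAW.weight D.carrier δ (a δ) (b δ) {γ₀} ≤
          Literature.Probability.RandomPlanarGeometry.SAW.weight D.carrier δ (a δ) (b δ) Set.univ :=
        measure_mono (Set.subset_univ _)
      rw [h0, Literature.Probability.RandomPlanarGeometry.SAW.weight_singleton, nonpos_iff_eq_zero,
        ENNReal.ofReal_eq_zero] at h1
      have : 0 < Literature.Probability.RandomPlanarGeometry.SAW.criticalFugacity ^ γ₀.length :=
        pow_pos Literature.Probability.RandomPlanarGeometry.SAW.criticalFugacity_pos_lt_one'.1 _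
      linarith
    constructor
    rw [Literature.Probability.RandomPlanarGeometry.SAW.law, Measure.smul_apply, smul_eq_mul,
      ENNReal.inv_mul_cancel hpos htop]
  -- (3) a family of probability measures on `CurveClass ℂ` agreeing with the push-forward SAW
  -- laws for all small `δ` (the criterion needs probability laws at EVERY index)
  have hmeas : ∀ δ, Measurable (fun γ :
      Literature.Probability.RandomPlanarGeometry.SAW.DomainSAW D.carrier δ (a δ) (b δ) => γ.curve) :=
    fun δ => Literature.Probability.RandomPlanarGeometry.SAW.DomainSAW.measurable_of_top _
  let c₀ : Literature.Probability.RandomPlanarGeometry.CurveClass ℂ :=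
    Literature.Probability.RandomPlanarGeometry.CurveClass.mk
      (Literature.Probability.RandomPlanarGeometry.Curve.const 0)
  let P' : ℝ → Measure (Literature.Probability.RandomPlanarGeometry.CurveClass ℂ) := fun δ =>
    if IsProbabilityMeasure (Literature.Probability.RandomPlanarGeometry.SAW.law D.carrier δ (a δ) (b δ))
    then (Literature.Probability.RandomPlanarGeometry.SAW.law D.carrier δ (a δ) (b δ)).map
      (fun γ => γ.curve)
    else Measure.dirac c₀
  have hP'eq : ∀ δ, IsProbabilityMeasure
      (Literature.Probability.RandomPlanarGeometry.SAW.law D.carrier δ (a δ) (b δ)) →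
      P' δ = (Literature.Probability.RandomPlanarGeometry.SAW.law D.carrier δ (a δ) (b δ)).map
        (fun γ => γ.curve) := fun δ h => if_pos h
  haveI hP' : ∀ δ, IsProbabilityMeasure (P' δ) := by
    intro δ
    by_cases h : IsProbabilityMeasure
        (Literature.Probability.RandomPlanarGeometry.SAW.law D.carrier δ (a δ) (b δ))
    · rw [hP'eq δ h]
      exact Measure.isProbabilityMeasure_map (hmeas δ).aemeasurable
    · have : P' δ = Measure.dirac c₀ := if_neg h
      rw [this]
      exact Measure.dirac.isProbabilityMeasure
  have hint : ∀ δ, IsProbabilityMeasure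
      (Literature.Probability.RandomPlanarGeometry.SAW.law D.carrier δ (a δ) (b δ)) →
      ∀ f : BoundedContinuousFunction (Literature.Probability.RandomPlanarGeometry.CurveClass ℂ) ℝ,
        ∫ x, f x ∂(P' δ) = ∫ γ, f γ.curve
          ∂(Literature.Probability.RandomPlanarGeometry.SAW.law D.carrier δ (a δ) (b δ)) := by
    intro δ h f
    rw [hP'eq δ h, integral_map (hmeas δ).aemeasurable f.continuous.aestronglyMeasurable]
  -- (4) Prokhorov + uniqueness of the SLE_{8/3} law (the PROVED criterion, `huniq` discharged by
  -- `IsSLECurve.map_eq_holds`), for the identity on `CurveClass ℂ` under `P'`: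
  -- tightness = EventualTight, identification = SubseqIdentification, both through the germ at 0⁺
  have hconv : Literature.Probability.RandomPlanarGeometry.ConvergesInLawToSLE ((8 : NNReal) / 3) D
      (Ωδ := fun _ => Literature.Probability.RandomPlanarGeometry.CurveClass ℂ) (fun _ => id) P' := by
    refine Literature.Probability.RandomPlanarGeometry.convergesInLawToSLE_of_isTightAlongMesh'
      (Eventually.of_forall fun δ => measurable_id.aemeasurable) ?_ ?_
    · intro ε hε
      obtain ⟨K, hK, hev⟩ := h_EventualTight D a b hab ε hε
      refine ⟨K, hK, ?_⟩
      filter_upwards [hev, hgood] with δ hδ hg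
      change P' δ Kᶜ ≤ ε
      rw [hP'eq δ hg, Measure.map_apply (hmeas δ) hK.isClosed.isOpen_compl.measurableSet]
      exact hδ
    · intro μ hμ hsub
      obtain ⟨s, hs, hlim⟩ := hsub
      refine hI D a b hab s μ hs hμ fun f => ?_
      have hev : ∀ᶠ n in atTop, IsProbabilityMeasure
          (Literature.Probability.RandomPlanarGeometry.SAW.law D.carrier (s n) (a (s n)) (b (s n))) :=
        hs.eventually hgood
      refine (hlim f).congr' ?_
      filter_upwards [hev] with n hn
      exact hint (s n) hn f
  -- (5) back to the SAW laws themselves (eventual equality of the test integrals)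
  obtain ⟨Γ, hΓ, -, hTL⟩ := hconv
  refine ⟨Γ, hΓ, Eventually.of_forall fun δ =>
    Literature.Probability.RandomPlanarGeometry.SAW.aemeasurable_curve _ _ _ _, fun f => ?_⟩
  refine (hTL f).congr' ?_
  filter_upwards [hgood] with δ hg
  exact hint δ hg f

end Summit.CriticalPhenomena.SAWScalingLimit.Theses.SAWExcursionCardy
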